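import Summits.CriticalPhenomena.PercolationContinuityZ3.Theorems.PercNearOneGluingNoHeavyLowerTailSunflowerSafeCalculus
import HarnessLib
import HarnessLib.Audit

/-!
# `NoHeavyLowerTail` (crux stmt-CriticalPhenomena-4575), abstract sunflower cubic, LAW LEVEL: the PIVOT conjecture
# "a core at least as heavy as the bottom is safe" (`CondSafeLaw`), its three-petal reading (Lemma A when `μ(A) ≥ μ(B)`),
# the law-level dichotomy `HmaxLaw` and `HmaxLaw ⇒ H_{q+t}`-row

Support file (seat `prim-l12-p2` gen 21; `--supports stmt-CriticalPhenomena-4575`).  No `sorry`.  Two new definitions, both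
`@[conjecture]` (obligations of this programme — census-true, unproved —, never facts).
Memo: run/shared/lean/prim/prim-l12/prim-l12-p2/FINDING-g21-LEMMA-B-IDENTITY-AND-MATROID-PARTITION.md §4.

CONTEXT.  `SafeCalc.Safe p A` (prove-1 g34) asks `∏ μ(V i) ≤ μ(A)^(n−1)` for EVERY family of up-sets meeting pairwise inside `A`;
safe cores satisfy all law-level rows (`lawH_nonneg_of_safe`, (C1-law) `e3_le_max_mul_AG_of_safe`), but not every core is safe
(majority cores of products: Lemma A fails when `μ(A) < μ(B)`).  Gen 21's census finding: the failure is governed by the MASSES,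
not by the core —

* `CondSafeLaw` (conjecture P_k, NEW): for every product measure and every SUNFLOWER of `n ≥ 2` up-sets (all pairwise intersections
  EQUAL to `A`) whose bottom `B = (⋃ V i)ᶜ` is not heavier than the core, `μ(B) ≤ μ(A)`, one has `∏ μ(V i) ≤ μ(A)^(n−1)` — equivalently
  `∏_i P(A | V i) ≥ P(A)`.  It is an IDENTITY on every star-type composition (`V i = ⋂_{j≠i} U j`, independent groups, any gadgets,
  any `p`: `∏ μ(V i) = μ(A)^(n−1)`), and `n = 2` is Harris.  EVIDENCE (gen 21): `n = 3`: every monotone map on ≤ 5 points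
  (12 / 12 132 / 126 728 700 labelled outer maps) × random + coordinate-ascent product measures, 0 violations (kit j137050), random sunflowers
  on 6–8 points 0 violations; `n = 4`: all 7 464 monotone maps `2^4 → M_4` × 40 optimised measures, 0 violations; `n = 4, 5` random on ≤ 10 points:
  0 violations; worst ratio exactly `1` (stars).  The hypothesis is sharp: OR-products violate Lemma A as soon as `μ(B) > μ(A)`.
* `lemmaA_of_condSafeLaw`, `e3_le_core_mul_AG_of_condSafeLaw` : the three-petal reading — `μ(B) ≤ μ(A) ⇒ μ(E₁)μ(E₂)μ(E₃) ≤ μ(A)²`,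
  i.e. `e₃ ≤ a·(ab − e₂)` (Lemma A, law level).
* `HmaxLaw` (conjecture, the law-level dichotomy = abstract form of the census row SF3-Hmax): `e₃ ≤ max(a,b)·(ab − e₂)` for every
  three-petal sunflower and product measure (the conclusion of `e3_le_max_mul_AG_of_safe` with no safety hypothesis).  By complementation
  duality (`prodBernoulli_map_compl`, `p ↦ 1 − p`, `A ↔ B`) `CondSafeLaw` (n = 3) gives both halves; here only the half `μ(B) ≤ μ(A)` is
  derived (`hmaxLaw_half_of_condSafeLaw`).  EVIDENCE: kit j136828 (same 126.7 M outer maps: 0 violations).  NOTE: the PARTITION-level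
  dichotomy `PurePayer` is FALSE (`not_purePayer`, cyclic star on 9 points) — the law-level form must be proved by a law-level argument.
* **`lawH_nonneg_of_hmaxLaw`** : `HmaxLaw ⇒ (a+b)(ab − e₂) − e₃ ≥ 0` (the abstract `H_{q+t}` row) for every three-petal sunflower.
-/

noncomputable section

namespace Summit.CriticalPhenomena.PercolationContinuityZ3.Theorems.SunflowerPartition

open MeasureTheory Finset
open Literature.Probability.LatticeModels Literature.Probability.Percolation

/-! ## The conjectures -/

/-- **CONDITIONAL SAFETY / PIVOT CONJECTURE P_k** (this work; OPEN, census-clean — file header): a sunflower of `n ≥ 2` up-sets whose bottom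
is not heavier than its core satisfies `∏ μ(V i) ≤ μ(A)^(n−1)`.  An obligation, never a fact: use as `(h : CondSafeLaw)`. [status: open] -/
@[conjecture] def CondSafeLaw : Prop :=
  ∀ (ι : Type) [Fintype ι] [DecidableEq ι] (p : ι → unitInterval) (n : ℕ) (V : Fin n → Set (Set ι)) (A : Set (Set ι)),
    2 ≤ n → (∀ i, IsUpperSet (V i)) → (∀ i j, i ≠ j → V i ∩ V j = A) →
    (prodBernoulli p).real (⋃ i, V i)ᶜ ≤ (prodBernoulli p).real A →
    ∏ i, (prodBernoulli p).real (V i) ≤ ((prodBernoulli p).real A) ^ (n - 1)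

/-- **LAW-LEVEL DICHOTOMY `Hmax`** (this work; OPEN, census-clean — file header): for every three-petal sunflower of up-sets and every
product measure, `e₃ ≤ max(a, b)·(ab − e₂)` (`a = μ(A)`, `b = μ((E₁ ∪ E₂ ∪ E₃)ᶜ)`, `c_i = μ(E_i ∖ A)`).  An obligation, never a fact:
use as `(h : HmaxLaw)`. [status: open] -/
@[conjecture] def HmaxLaw : Prop :=
  ∀ (ι : Type) [Fintype ι] [DecidableEq ι] (p : ι → unitInterval) (E₁ E₂ E₃ A : Set (Set ι)),
    IsUpperSet E₁ → IsUpperSet E₂ → IsUpperSet E₃ → E₁ ∩ E₂ = A → E₁ ∩ E₃ = A → E₂ ∩ E₃ = A →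
    (prodBernoulli p).real (E₁ \ A) * (prodBernoulli p).real (E₂ \ A) * (prodBernoulli p).real (E₃ \ A) ≤
      max ((prodBernoulli p).real A) ((prodBernoulli p).real (E₁ ∪ E₂ ∪ E₃)ᶜ) *
        ((prodBernoulli p).real A * (prodBernoulli p).real (E₁ ∪ E₂ ∪ E₃)ᶜ -
          ((prodBernoulli p).real (E₁ \ A) * (prodBernoulli p).real (E₂ \ A) +
            (prodBernoulli p).real (E₁ \ A) * (prodBernoulli p).real (E₃ \ A) +
            (prodBernoulli p).real (E₂ \ A) * (prodBernoulli p).real (E₃ \ A)))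

/-! ## `HmaxLaw ⇒` the law-level `H` row -/

/-- **`HmaxLaw ⇒ H_{q+t}`-row** (this work): `0 ≤ (a+b)(ab − e₂) − e₃` for every three-petal sunflower of up-sets, since
`max(a,b) ≤ a + b` and `ab − e₂ ≥ 0` (Gladkov, `prodBernoulli_strongHarris_sunflower_three`). [this work] -/
theorem lawH_nonneg_of_hmaxLaw (h : HmaxLaw) {ι : Type} [Fintype ι] [DecidableEq ι] (p : ι → unitInterval)
    {E₁ E₂ E₃ A : Set (Set ι)} (h₁ : IsUpperSet E₁) (h₂ : IsUpperSet E₂) (h₃ : IsUpperSet E₃)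
    (h12 : E₁ ∩ E₂ = A) (h13 : E₁ ∩ E₃ = A) (h23 : E₂ ∩ E₃ = A) :
    0 ≤ ((prodBernoulli p).real A + (prodBernoulli p).real (E₁ ∪ E₂ ∪ E₃)ᶜ) *
        ((prodBernoulli p).real A * (prodBernoulli p).real (E₁ ∪ E₂ ∪ E₃)ᶜ -
          ((prodBernoulli p).real (E₁ \ A) * (prodBernoulli p).real (E₂ \ A) +
            (prodBernoulli p).real (E₁ \ A) * (prodBernoulli p).real (E₃ \ A) +
            (prodBernoulli p).real (E₂ \ A) * (prodBernoulli p).real (E₃ \ A))) -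
      (prodBernoulli p).real (E₁ \ A) * (prodBernoulli p).real (E₂ \ A) * (prodBernoulli p).real (E₃ \ A) := by
  have hmax := h ι p E₁ E₂ E₃ A h₁ h₂ h₃ h12 h13 h23
  have hAG := prodBernoulli_strongHarris_sunflower_three p h₁ h₂ h₃ h12 h13 h23
  have ha : 0 ≤ (prodBernoulli p).real A := measureReal_nonneg
  have hb : 0 ≤ (prodBernoulli p).real (E₁ ∪ E₂ ∪ E₃)ᶜ := measureReal_nonneg
  have hm : max ((prodBernoulli p).real A) ((prodBernoulli p).real (E₁ ∪ E₂ ∪ E₃)ᶜ)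
      ≤ (prodBernoulli p).real A + (prodBernoulli p).real (E₁ ∪ E₂ ∪ E₃)ᶜ := max_le (by linarith) (by linarith)
  nlinarith [hm, hAG, hmax, ha, hb]

/-! ## The three-petal reading of `CondSafeLaw` -/

/-- **Lemma A when the core outweighs the bottom** (this work): `CondSafeLaw ⇒ μ(E₁)μ(E₂)μ(E₃) ≤ μ(A)²` for every three-petal sunflower with
`μ((E₁ ∪ E₂ ∪ E₃)ᶜ) ≤ μ(A)`. [this work] -/
theorem lemmaA_of_condSafeLaw (h : CondSafeLaw) {ι : Type} [Fintype ι] [DecidableEq ι] (p : ι → unitInterval)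
    {E₁ E₂ E₃ A : Set (Set ι)} (h₁ : IsUpperSet E₁) (h₂ : IsUpperSet E₂) (h₃ : IsUpperSet E₃)
    (h12 : E₁ ∩ E₂ = A) (h13 : E₁ ∩ E₃ = A) (h23 : E₂ ∩ E₃ = A)
    (hab : (prodBernoulli p).real (E₁ ∪ E₂ ∪ E₃)ᶜ ≤ (prodBernoulli p).real A) :
    (prodBernoulli p).real E₁ * (prodBernoulli p).real E₂ * (prodBernoulli p).real E₃ ≤ ((prodBernoulli p).real A) ^ 2 := by
  let V : Fin 3 → Set (Set ι) := ![E₁, E₂, E₃]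
  have hV : ∀ i, IsUpperSet (V i) := by
    intro i; fin_cases i
    · exact h₁
    · exact h₂
    · exact h₃
  have hcap : ∀ i j, i ≠ j → V i ∩ V j = A := by
    intro i j hij
    fin_cases i <;> fin_cases j
    all_goals first
      | exact (hij rfl).elim
      | (change E₁ ∩ E₂ = A; exact h12)
      | (change E₂ ∩ E₁ = A; rw [Set.inter_comm]; exact h12)
      | (change E₁ ∩ E₃ = A; exact h13)
      | (change E₃ ∩ E₁ = A; rw [Set.inter_comm]; exact h13)
      | (change E₂ ∩ E₃ = A; exact h23)
      | (change E₃ ∩ E₂ = A; rw [Set.inter_comm]; exact h23)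
  have hU : (⋃ i, V i) = E₁ ∪ E₂ ∪ E₃ := by
    ext ω
    simp only [Set.mem_iUnion, Set.mem_union]
    constructor
    · rintro ⟨i, hi⟩
      fin_cases i
      · exact Or.inl (Or.inl hi)
      · exact Or.inl (Or.inr hi)
      · exact Or.inr hi
    · rintro ((hi | hi) | hi)
      · exact ⟨0, hi⟩
      · exact ⟨1, hi⟩
      · exact ⟨2, hi⟩
  have hab' : (prodBernoulli p).real (⋃ i, V i)ᶜ ≤ (prodBernoulli p).real A := by rw [hU]; exact hab
  have key := h ι p 3 V A (by norm_num) hV hcap hab'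
  rw [Fin.prod_univ_three] at key
  simp only [V, Matrix.cons_val_zero, Matrix.cons_val_one, Matrix.cons_val] at key
  calc (prodBernoulli p).real E₁ * (prodBernoulli p).real E₂ * (prodBernoulli p).real E₃
      ≤ ((prodBernoulli p).real A) ^ (3 - 1) := key
    _ = ((prodBernoulli p).real A) ^ 2 := by norm_num

/-- **Lemma A in cells** (this work): `CondSafeLaw ⇒ e₃ ≤ a·(ab − e₂)` whenever `b ≤ a`. [this work] -/
theorem e3_le_core_mul_AG_of_condSafeLaw (h : CondSafeLaw) {ι : Type} [Fintype ι] [DecidableEq ι] (p : ι → unitInterval)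
    {E₁ E₂ E₃ A : Set (Set ι)} (h₁ : IsUpperSet E₁) (h₂ : IsUpperSet E₂) (h₃ : IsUpperSet E₃)
    (h12 : E₁ ∩ E₂ = A) (h13 : E₁ ∩ E₃ = A) (h23 : E₂ ∩ E₃ = A)
    (hab : (prodBernoulli p).real (E₁ ∪ E₂ ∪ E₃)ᶜ ≤ (prodBernoulli p).real A) :
    (prodBernoulli p).real (E₁ \ A) * (prodBernoulli p).real (E₂ \ A) * (prodBernoulli p).real (E₃ \ A) ≤
      (prodBernoulli p).real A * ((prodBernoulli p).real A * (prodBernoulli p).real (E₁ ∪ E₂ ∪ E₃)ᶜ -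
        ((prodBernoulli p).real (E₁ \ A) * (prodBernoulli p).real (E₂ \ A) +
          (prodBernoulli p).real (E₁ \ A) * (prodBernoulli p).real (E₃ \ A) +
          (prodBernoulli p).real (E₂ \ A) * (prodBernoulli p).real (E₃ \ A))) := by
  have key := lemmaA_of_condSafeLaw h p h₁ h₂ h₃ h12 h13 h23 hab
  obtain ⟨e₁, e₂, e₃, eB⟩ := PrincipalCore.cells_eq p h12 h13 h23
  rw [e₁, e₂, e₃] at key
  rw [eB] at hab ⊢
  nlinarith [key]

/-- **The `b ≤ a` half of `HmaxLaw` from `CondSafeLaw`** (this work). [this work] -/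
theorem hmaxLaw_half_of_condSafeLaw (h : CondSafeLaw) {ι : Type} [Fintype ι] [DecidableEq ι] (p : ι → unitInterval)
    {E₁ E₂ E₃ A : Set (Set ι)} (h₁ : IsUpperSet E₁) (h₂ : IsUpperSet E₂) (h₃ : IsUpperSet E₃)
    (h12 : E₁ ∩ E₂ = A) (h13 : E₁ ∩ E₃ = A) (h23 : E₂ ∩ E₃ = A)
    (hab : (prodBernoulli p).real (E₁ ∪ E₂ ∪ E₃)ᶜ ≤ (prodBernoulli p).real A) :
    (prodBernoulli p).real (E₁ \ A) * (prodBernoulli p).real (E₂ \ A) * (prodBernoulli p).real (E₃ \ A) ≤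
      max ((prodBernoulli p).real A) ((prodBernoulli p).real (E₁ ∪ E₂ ∪ E₃)ᶜ) *
        ((prodBernoulli p).real A * (prodBernoulli p).real (E₁ ∪ E₂ ∪ E₃)ᶜ -
          ((prodBernoulli p).real (E₁ \ A) * (prodBernoulli p).real (E₂ \ A) +
            (prodBernoulli p).real (E₁ \ A) * (prodBernoulli p).real (E₃ \ A) +
            (prodBernoulli p).real (E₂ \ A) * (prodBernoulli p).real (E₃ \ A))) := by
  have hLA := e3_le_core_mul_AG_of_condSafeLaw h p h₁ h₂ h₃ h12 h13 h23 hab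
  rw [max_eq_left hab]
  exact hLA

end Summit.CriticalPhenomena.PercolationContinuityZ3.Theorems.SunflowerPartition
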